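import Mathlib.Data.NNReal.Defs
import Mathlib.Algebra.Order.Group.MinMax
import Mathlib.Tactic.LinearCombination
import Literature.AlgebraicGeometry.Frobenioids.ModelFrobenioid
import HarnessLib

/-!
# Frobenioids I, Def. 2.4 (i): an `ℝ_{≥0}`-action on a monoid makes its groupification an `ℝ`-vector space

Mochizuki, *The geometry of Frobenioids I*, Kyushu J. Math. **62** (2008), §2, Definition 2.4 (i) p. 48:
"`(M^rlf)^gp ⊆ (M^rlf_factor)^gp = ∏' (M^rlf_𝔭)^gp` [is] an `ℝ`-vector space … generated by `M^rlf`", and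
Proposition 5.3 p. 103: "the rational function monoid `ℝ · Φ^birat ⊆ (Φ^rlf)^gp`"
[cite: MochizukiFrdI2008, Def. 2.4(i) p.48] [cite: MochizukiFrdI2008, Prop. 5.3 p.103].

The (tacit, elementary) algebra behind these sentences, in the tree's multiplicative notation
(`M^gp = Algebra.GrothendieckGroup M`, a power `x^r` for the additive `r • x`): if `ℝ_{≥0}` acts on a
commutative monoid `P` by monoid endomorphisms `x ↦ x^r` with `x^0 = 1`, `x^1 = x`, `x^{r+s} = x^r x^s`,
`x^{rs} = (x^s)^r`, then `ℝ` acts on `P^gp` by `r • [x] := [x^{r⁺}] / [x^{r⁻}]` (`r = r⁺ − r⁻`),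
additively and multiplicatively in `r`, unitally, extending the `ℝ_{≥0}`-action, and naturally with
respect to equivariant homomorphisms.  GENERIC in the action `act : ℝ_{≥0} → (P →* P)` (the laws enter
as hypotheses of the theorems, not as data); instantiated for `P = M^rlf` with `act = Rlf.rpow`
(`RealificationRPow.lean`) in `RealificationDataCanonical.lean`, where it supplies the fields `rsmul`,
`rsmul_add`, `rsmul_mul`, `rsmul_one`, `pullGp_rsmul` of the tree's interface `RealificationData`
(`RationalFunctionSubfunctors.lean`).  No statement of the paper is re-typed.
Seat abc-iut-L1-d2 (cell abc-iut), row «FrdI:Def2.4(ii)-ℝ-action + I3-MERGE» (L1-lead R45 (4)).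
-/

noncomputable section

namespace Literature.AlgebraicGeometry.Frobenioids

open Function

universe u

namespace RealAction

variable {P : Type u} [CommMonoid P] (act : NNReal → (P →* P))

/-! ### The `ℝ`-action on `P^gp` induced by an `ℝ_{≥0}`-action on `P` -/

/-- For `r ∈ ℝ`, the homomorphism `P → P^gp`, `x ↦ [x^{r⁺}] / [x^{r⁻}]` (`r⁺ = max(r,0)`, `r⁻ = max(−r,0)`).
[cite: MochizukiFrdI2008, Def. 2.4(i) p.48] -/
def gpSMulGen (r : ℝ) : P →* Algebra.GrothendieckGroup P :=
  (Algebra.GrothendieckGroup.of.comp (act r.toNNReal)) / (Algebra.GrothendieckGroup.of.comp (act (-r).toNNReal))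

/-- **`r • (−)` on `P^gp`** for `r ∈ ℝ`: the unique homomorphism `P^gp → P^gp` extending
`x ↦ [x^{r⁺}] / [x^{r⁻}]` (universal property of the groupification, §0 p. 11).
[cite: MochizukiFrdI2008, Def. 2.4(i) p.48] -/
def gpSMul (r : ℝ) : Algebra.GrothendieckGroup P →* Algebra.GrothendieckGroup P :=
  Algebra.GrothendieckGroup.lift (gpSMulGen act r)

/-- `r • [x] = [x^{r⁺}] / [x^{r⁻}]`. [cite: MochizukiFrdI2008, Def. 2.4(i) p.48] -/
theorem gpSMul_of (r : ℝ) (x : P) :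
    gpSMul act r (Algebra.GrothendieckGroup.of x) =
      Algebra.GrothendieckGroup.of (act r.toNNReal x) / Algebra.GrothendieckGroup.of (act (-r).toNNReal x) := by
  have h := Algebra.GrothendieckGroup.lift.symm_apply_apply (gpSMulGen act r)
  rw [Algebra.GrothendieckGroup.lift_symm_apply] at h
  have h' := DFunLike.congr_fun h x
  rw [MonoidHom.comp_apply] at h'
  rw [gpSMul, h']
  rfl

variable (hadd : ∀ (r s : NNReal) (x : P), act (r + s) x = act r x * act s x)
include hadd

/-- **Key formula.** If `r = a − b` with `a, b ≥ 0` then `r • [x] = [x^a] / [x^b]` — the definition does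
not depend on the decomposition of `r` (uses `x^{r+s} = x^r x^s`). [cite: MochizukiFrdI2008, Def. 2.4(i) p.48] -/
theorem gpSMul_of_eq_div {r : ℝ} {a b : NNReal} (hr : (a : ℝ) - b = r) (x : P) :
    gpSMul act r (Algebra.GrothendieckGroup.of x) =
      Algebra.GrothendieckGroup.of (act a x) / Algebra.GrothendieckGroup.of (act b x) := by
  rw [gpSMul_of, div_eq_div_iff_mul_eq_mul, ← map_mul, ← map_mul, ← hadd, ← hadd]
  have h1 : ((r.toNNReal : NNReal) : ℝ) - (((-r).toNNReal : NNReal) : ℝ) = r := by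
    rw [Real.coe_toNNReal', Real.coe_toNNReal', max_zero_sub_max_neg_zero_eq_self]
  have h2 : r.toNNReal + b = a + (-r).toNNReal := by
    apply NNReal.coe_injective
    rw [NNReal.coe_add, NNReal.coe_add]
    linarith
  rw [h2]

/-- On `[x]` with `r ≥ 0` the action is the given one: `r • [x] = [x^r]`; here for `r : ℝ_{≥0}` and
assuming `x^0 = 1`. [cite: MochizukiFrdI2008, Def. 2.4(i) p.48] -/
theorem gpSMul_coe_of (h0 : ∀ x : P, act 0 x = 1) (r : NNReal) (x : P) :
    gpSMul act (r : ℝ) (Algebra.GrothendieckGroup.of x) = Algebra.GrothendieckGroup.of (act r x) := by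
  rw [gpSMul_of_eq_div act hadd (a := r) (b := 0) (by rw [NNReal.coe_zero, sub_zero]), h0, map_one, div_one]

/-- `(r + s) • ξ = (r • ξ)(s • ξ)` (additivity in the scalar). [cite: MochizukiFrdI2008, Def. 2.4(i) p.48] -/
theorem gpSMul_add (r s : ℝ) (ξ : Algebra.GrothendieckGroup P) :
    gpSMul act (r + s) ξ = gpSMul act r ξ * gpSMul act s ξ := by
  rw [← MonoidHom.mul_apply]
  refine DFunLike.congr_fun (MonGp.hom_ext fun x => ?_) ξ
  rw [MonoidHom.mul_apply, gpSMul_of act r, gpSMul_of act s, ← mul_div_mul_comm, ← map_mul, ← map_mul,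
    ← hadd, ← hadd]
  apply gpSMul_of_eq_div act hadd
  have hr : ((r.toNNReal : NNReal) : ℝ) - (((-r).toNNReal : NNReal) : ℝ) = r := by
    rw [Real.coe_toNNReal', Real.coe_toNNReal', max_zero_sub_max_neg_zero_eq_self]
  have hs : ((s.toNNReal : NNReal) : ℝ) - (((-s).toNNReal : NNReal) : ℝ) = s := by
    rw [Real.coe_toNNReal', Real.coe_toNNReal', max_zero_sub_max_neg_zero_eq_self]
  rw [NNReal.coe_add, NNReal.coe_add]
  linarith

/-- `0 • ξ = 1` (assuming `x^0 = 1`). [cite: MochizukiFrdI2008, Def. 2.4(i) p.48] -/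
theorem gpSMul_zero (h0 : ∀ x : P, act 0 x = 1) (ξ : Algebra.GrothendieckGroup P) : gpSMul act 0 ξ = 1 := by
  rw [← MonoidHom.one_apply (M := Algebra.GrothendieckGroup P) (N := Algebra.GrothendieckGroup P) ξ]
  refine DFunLike.congr_fun (MonGp.hom_ext fun x => ?_) ξ
  rw [MonoidHom.one_apply, ← NNReal.coe_zero, gpSMul_coe_of act hadd h0, h0, map_one]

/-- `(−r) • ξ = (r • ξ)⁻¹`. [cite: MochizukiFrdI2008, Def. 2.4(i) p.48] -/
theorem gpSMul_neg (r : ℝ) (ξ : Algebra.GrothendieckGroup P) : gpSMul act (-r) ξ = (gpSMul act r ξ)⁻¹ := by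
  rw [← MonoidHom.inv_apply]
  refine DFunLike.congr_fun (MonGp.hom_ext fun x => ?_) ξ
  rw [MonoidHom.inv_apply, gpSMul_of act r, inv_div]
  apply gpSMul_of_eq_div act hadd
  have hr : ((r.toNNReal : NNReal) : ℝ) - (((-r).toNNReal : NNReal) : ℝ) = r := by
    rw [Real.coe_toNNReal', Real.coe_toNNReal', max_zero_sub_max_neg_zero_eq_self]
  linarith

/-- `1 • ξ = ξ` (assuming `x^0 = 1` and `x^1 = x`). [cite: MochizukiFrdI2008, Def. 2.4(i) p.48] -/
theorem gpSMul_one (h0 : ∀ x : P, act 0 x = 1) (h1 : ∀ x : P, act 1 x = x)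
    (ξ : Algebra.GrothendieckGroup P) : gpSMul act 1 ξ = ξ := by
  rw [← MonoidHom.id_apply (Algebra.GrothendieckGroup P) ξ]
  refine DFunLike.congr_fun (MonGp.hom_ext fun x => ?_) ξ
  rw [MonoidHom.id_apply, ← NNReal.coe_one, gpSMul_coe_of act hadd h0, h1]

/-- `(r s) • ξ = r • (s • ξ)` (assuming `x^{rs} = (x^s)^r`). [cite: MochizukiFrdI2008, Def. 2.4(i) p.48] -/
theorem gpSMul_mul (hmul : ∀ (r s : NNReal) (x : P), act (r * s) x = act r (act s x)) (r s : ℝ)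
    (ξ : Algebra.GrothendieckGroup P) : gpSMul act (r * s) ξ = gpSMul act r (gpSMul act s ξ) := by
  rw [← MonoidHom.comp_apply]
  refine DFunLike.congr_fun (MonGp.hom_ext fun x => ?_) ξ
  rw [MonoidHom.comp_apply, gpSMul_of act s, map_div, gpSMul_of act r, gpSMul_of act r, div_div_div_eq,
    ← map_mul, ← map_mul, ← hmul, ← hmul, ← hmul, ← hmul, ← hadd, ← hadd]
  apply gpSMul_of_eq_div act hadd
  have hr : ((r.toNNReal : NNReal) : ℝ) - (((-r).toNNReal : NNReal) : ℝ) = r := by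
    rw [Real.coe_toNNReal', Real.coe_toNNReal', max_zero_sub_max_neg_zero_eq_self]
  have hs : ((s.toNNReal : NNReal) : ℝ) - (((-s).toNNReal : NNReal) : ℝ) = s := by
    rw [Real.coe_toNNReal', Real.coe_toNNReal', max_zero_sub_max_neg_zero_eq_self]
  rw [NNReal.coe_add, NNReal.coe_add, NNReal.coe_mul, NNReal.coe_mul, NNReal.coe_mul, NNReal.coe_mul]
  linear_combination (((s.toNNReal : NNReal) : ℝ) - (((-s).toNNReal : NNReal) : ℝ)) * hr + r * hs

omit hadd in
/-- **Naturality.** A homomorphism `ψ : P^gp → P'^gp` lying over an EQUIVARIANT `φ : P → P'`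
(`φ(x^r) = φ(x)^r`) is `ℝ`-linear: `ψ(r • ξ) = r • ψ(ξ)`. [cite: MochizukiFrdI2008, Def. 2.4(i) p.48] -/
theorem map_gpSMul {P' : Type u} [CommMonoid P'] (act' : NNReal → (P' →* P')) (φ : P →* P')
    (hφ : ∀ (r : NNReal) (x : P), φ (act r x) = act' r (φ x))
    (ψ : Algebra.GrothendieckGroup P →* Algebra.GrothendieckGroup P')
    (hψ : ∀ x : P, ψ (Algebra.GrothendieckGroup.of x) = Algebra.GrothendieckGroup.of (φ x))
    (r : ℝ) (ξ : Algebra.GrothendieckGroup P) : ψ (gpSMul act r ξ) = gpSMul act' r (ψ ξ) := by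
  rw [← MonoidHom.comp_apply, ← MonoidHom.comp_apply (gpSMul act' r)]
  refine DFunLike.congr_fun (MonGp.hom_ext fun x => ?_) ξ
  rw [MonoidHom.comp_apply, MonoidHom.comp_apply, gpSMul_of, map_div, hψ, hψ, hφ, hφ, hψ, gpSMul_of]

omit hadd in
/-- Naturality for the groupification `φ^gp = MonGp.map φ` of an equivariant `φ`.
[cite: MochizukiFrdI2008, Def. 2.4(i) p.48] -/
theorem monGpMap_gpSMul {P' : Type u} [CommMonoid P'] (act' : NNReal → (P' →* P')) (φ : P →* P')
    (hφ : ∀ (r : NNReal) (x : P), φ (act r x) = act' r (φ x)) (r : ℝ) (ξ : Algebra.GrothendieckGroup P) :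
    MonGp.map φ (gpSMul act r ξ) = gpSMul act' r (MonGp.map φ ξ) :=
  map_gpSMul act act' φ hφ (MonGp.map φ) (MonGp.map_of φ) r ξ

end RealAction

end Literature.AlgebraicGeometry.Frobenioids
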